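import Mathlib
import HarnessLib
import Summits.NavierStokesRegularity.NavierStokesRegularity.Theorems.WakeRatchetMinimalViscousBlowupClosedValve
import Summits.NavierStokesRegularity.NavierStokesRegularity.Theorems.WakeRatchetMinimalViscousBlowupEnergyBudget
import Summits.NavierStokesRegularity.NavierStokesRegularity.Theorems.WakeRatchetMinimalViscousBlowupEveryShellFires

/-!
# Route `WakeRatchet`, crux `MinimalViscousBlowup` (stmt-NavierStokesRegularity-22743), LINE g11-1 «threshold ray» (skeleton v3.10
# ebed8644104749ae), stub S5b♭₁ `stub_litMeasureAtThreshold` — the UNCONDITIONAL ONE-POWER rung (H1′): lit measure `≤ A·λ^{−k}`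

The open stub `stub_litMeasureAtThreshold` (H1″) asks, along the threshold blow-up, for the bound `volume{lit_k} ≤ A·λ^{−2k}` on the time shell `k`
spends above the darkness level.  This file proves the ENERGY half of it for EVERY regular trajectory of the NS-scaled `ν`-viscous lattice from
a one-shell datum — no threshold, no envelope, no blow-up, no clock: for every level `b > 0` and every shell `k`,

  `volume {s ∈ [0,T) : b < λ^k‖X_k(s)‖²} ≤ E₀/(ν b) · λ^{−k}`,   `E₀ = Σ_i ½ X₀ᵢ²`  (`litMeasure_le_energy`),

i.e. (H1″) with exponent ONE instead of two («one power short», STUB-PLAN-litMeasureAtThreshold §1: the missing power is exactly the clock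
of the feeder shell, `litMeasure_of_frontClock₂`).  Mechanism (Tao's energy identity + Chebyshev): on every `[0,T']`, `T' < T`, the truncated
energy `E_L = Σ_{j<L} ½‖X_j‖²` has `E_L' = −Π_{L−1} − ν Σ_{j<L} λ^{2j}‖X_j‖²` (`hasDerivWithinAt_blockEnergy`), the top flux is `≤ 4³M³λ^{−L}`
under the weight-10 bound (`abs_botSum_le_of_weight10`), so `∫_0^{T'} ν λ^{2k}‖X_k‖² ≤ E₀ + 4³M³λ^{−L}T'` for every `L > k`; on the lit set the
integrand is `> ν b λ^{k}`; Markov's inequality and `L → ∞`, then `T' ↑ T`.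
MODEL lattice only (nothing about Navier–Stokes; no NS regularity statement is proved; no stub is closed by name).
`--supports stmt-NavierStokesRegularity-22743 --as helper`.
[cite: Tao2016AveragedNS, §4 proof of (4.13) (energy identity with the cancellation (4.3)), Lemma 4.1 (4.5), (4.11)]
-/

noncomputable section

set_option linter.dupNamespace false

open Set Filter Topology MeasureTheory
open Literature.Analysis.FluidPDE Literature.Analysis.FluidPDE.TaoCascade

namespace Summit.NavierStokesRegularity.NavierStokesRegularity.Theorems.MinimalViscousBlowup.ThresholdRay

/-- **Dissipation budget ⇒ lit measure on a compact window (Markov).**  For a regular trajectory of the `ν`-viscous lattice on `[0,T)` from the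
one-shell datum `X₀` (cancelling table with `|α_{··(0,0,1)}| ≤ 1`), every `T' ∈ (0,T)`, level `b > 0` and shell `k`:
`volume ({s : b < λ^k‖X_k(s)‖²} ∩ (0,T']) ≤ E₀/(ν b λ^k)`, `E₀ = Σ_i ½X₀ᵢ²`. [cite: Tao2016AveragedNS, §4 proof of (4.13), Lemma 4.1 (4.5)] -/
theorem litMeasure_window_le_energy {ε₀ ν T T' b : ℝ} (hε : 0 < ε₀) (hν : 0 < ν)
    {α : Fin 4 → Fin 4 → Fin 4 → ℤ × ℤ × ℤ → ℝ} (hcan : IsCancellingCoeff α)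
    (hα1 : ∀ i₁ i₂ i₃, |α i₁ i₂ i₃ (0, 0, 1)| ≤ 1) {X : Fin 4 → ℤ → ℝ → ℝ} {X₀ : Fin 4 → ℝ}
    (hcd : ∀ i n, ContDiffOn ℝ 1 (X i n) (Ico 0 T))
    (hinit : ∀ i n, X i n 0 = if n = 0 then X₀ i else 0)
    (hlow : ∀ i n t, n < 0 → X i n t = 0)
    (hmot : ∀ i n t, 0 ≤ t → t < T → derivWithin (X i n) (Ici 0) t =
      quadTerm ε₀ α X i n t - ν * (1 + ε₀) ^ ((2 : ℝ) * n) * X i n t)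
    (hreg : ∀ T' : ℝ, 0 < T' → T' < T → ∃ M : ℝ, ∀ t : ℝ, 0 ≤ t → t ≤ T' →
      ∀ (i : Fin 4) (n : ℤ), (1 + (1 + ε₀) ^ ((10 : ℝ) * n)) * |X i n t| ≤ M)
    (hT'0 : 0 < T') (hT'T : T' < T) (hb : 0 < b) (k : ℕ) :
    volume ({s : ℝ | b < (1 + ε₀) ^ k * ‖shellVec X k s‖ ^ 2} ∩ Ioc 0 T') ≤
      ENNReal.ofReal ((∑ i : Fin 4, (1 / 2 : ℝ) * X₀ i ^ 2) / (ν * b * (1 + ε₀) ^ k)) := by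
  have hl0 : (0 : ℝ) < 1 + ε₀ := by linarith
  have hl1 : (1 : ℝ) < 1 + ε₀ := by linarith
  have hlow' : ∀ i n t, n < 0 → 0 ≤ t → X i n t = 0 := fun i n t hn _ => hlow i n t hn
  set E₀ : ℝ := ∑ i : Fin 4, (1 / 2 : ℝ) * X₀ i ^ 2 with hE₀
  have hE₀0 : 0 ≤ E₀ := Finset.sum_nonneg fun i _ => by positivity
  -- the larger window `[0,T'']` on which the motion law is available within `Icc`
  set T'' : ℝ := (T' + T) / 2 with hT''
  have hT'T'' : T' < T'' := by rw [hT'']; linarith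
  have hT''T : T'' < T := by rw [hT'']; linarith
  have hderW := hasDerivWithinAt_window_of_clauses (ε₀ := ε₀) (ν := ν) (α := α) hcd hmot hT''T
  -- weight-10 bound on `[0,T'']`, made nonnegative
  obtain ⟨M₀, hM₀⟩ := hreg T'' (hT'0.trans hT'T'') hT''T
  set M : ℝ := max M₀ 0 with hMdef
  have hM0 : 0 ≤ M := le_max_right _ _
  have hM : ∀ t : ℝ, 0 ≤ t → t ≤ T'' → ∀ (i : Fin 4) (n : ℤ), (1 + (1 + ε₀) ^ ((10 : ℝ) * n)) * |X i n t| ≤ M :=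
    fun t ht htT i n => (hM₀ t ht htT i n).trans (le_max_left _ _)
  -- the lit set, the Markov level `e = ν b λ^k`
  set S : Set ℝ := {s : ℝ | b < (1 + ε₀) ^ k * ‖shellVec X k s‖ ^ 2} with hSdef
  set e : ℝ := ν * b * (1 + ε₀) ^ k with hedef
  have he : 0 < e := by rw [hedef]; positivity
  set r : ℝ := (1 + ε₀)⁻¹ with hr
  have hr0 : 0 < r := by rw [hr]; exact inv_pos.2 hl0
  have hr1 : r < 1 := by rw [hr]; exact inv_lt_one_of_one_lt₀ hl1
  -- MAIN STEP: for every `L > k`, `volume.real (S ∩ Ioc 0 T') ≤ (E₀ + 4³M³ r^L T')/e`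
  have hstep : ∀ L : ℕ, k < L →
      (volume (S ∩ Ioc 0 T')).toReal ≤ (E₀ + (4 : ℝ) ^ 3 * M ^ 3 * r ^ L * T') / e := by
    intro L hkL
    have hL1 : 1 ≤ L := by omega
    set cL : ℝ := (4 : ℝ) ^ 3 * M ^ 3 * r ^ L with hcL
    have hcL0 : 0 ≤ cL := by rw [hcL]; positivity
    -- truncated energy, dissipation, top flux
    set EL : ℝ → ℝ := fun w => ∑ j ∈ Finset.Ico 0 L, ∑ i : Fin 4, (1 / 2 : ℝ) * X i j w ^ 2 with hEL
    set DL : ℝ → ℝ := fun u => ν * ∑ j ∈ Finset.Ico 0 L, (1 + ε₀) ^ ((2 : ℝ) * (j : ℤ)) * ∑ i : Fin 4, X i j u ^ 2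
      with hDL
    set BL : ℝ → ℝ := fun u => botSum ε₀ α X ((L : ℤ) - 1) u with hBL
    have hELder : ∀ u ∈ Icc (0 : ℝ) T'', HasDerivWithinAt EL (-BL u - DL u) (Icc 0 T'') u := by
      intro u hu
      have h := hasDerivWithinAt_blockEnergy (ε₀ := ε₀) (ν := ν) hcan (fun i j => hderW i j u hu) (Nat.zero_le L)
      have h0 : botSum ε₀ α X (((0 : ℕ) : ℤ) - 1) u = 0 := by
        rw [Nat.cast_zero, zero_sub]; exact botSum_neg_one_eq_zero hlow' hu.1
      rw [h0, zero_sub] at h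
      exact h
    -- top flux bound `|BL u| ≤ cL` on `[0,T'']`
    have hBLle : ∀ u ∈ Icc (0 : ℝ) T'', |BL u| ≤ cL := by
      intro u hu
      obtain ⟨L', hL'⟩ := Nat.exists_eq_add_of_le hL1
      have h := abs_botSum_le_of_weight10 (m := 4) hε hM0 hα1 (fun i n => hM u hu.1 hu.2 i n) L'
      have e1 : ((L : ℤ) - 1) = (L' : ℤ) := by rw [hL']; push_cast; ring
      have e2 : L' + 1 = L := by omega
      rw [hBL]; dsimp only; rw [e1]
      calc |botSum ε₀ α X (L' : ℤ) u| ≤ (4 : ℝ) ^ 3 * M ^ 3 * ((1 + ε₀)⁻¹) ^ (L' + 1) := by exact_mod_cast h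
        _ = cL := by rw [hcL, hr, e2]
    -- dissipation is nonnegative and dominates `e` on the lit set
    have hDL0 : ∀ u, 0 ≤ DL u := by
      intro u; rw [hDL]; dsimp only
      refine mul_nonneg hν.le (Finset.sum_nonneg fun j _ => mul_nonneg (Real.rpow_nonneg hl0.le _)
        (Finset.sum_nonneg fun i _ => sq_nonneg _))
    have hDLe : ∀ u ∈ S, e ≤ DL u := by
      intro u hu
      rw [hSdef] at hu
      have hu' : b < (1 + ε₀) ^ k * ‖shellVec X k u‖ ^ 2 := hu
      have hkmem : k ∈ Finset.Ico 0 L := Finset.mem_Ico.mpr ⟨Nat.zero_le _, hkL⟩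
      have hterm : (1 + ε₀) ^ ((2 : ℝ) * ((k : ℕ) : ℤ)) * ∑ i : Fin 4, X i k u ^ 2
          = (1 + ε₀) ^ k * ((1 + ε₀) ^ k * ‖shellVec X k u‖ ^ 2) := by
        rw [norm_shellVec_sq]
        have : (1 + ε₀) ^ ((2 : ℝ) * ((k : ℕ) : ℤ)) = (1 + ε₀) ^ k * (1 + ε₀) ^ k := by
          rw [show (2 : ℝ) * (((k : ℕ) : ℤ) : ℝ) = ((2 * k : ℕ) : ℝ) by push_cast; ring, Real.rpow_natCast,
            two_mul, pow_add]
        rw [this]; ring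
      have hsingle : (1 + ε₀) ^ ((2 : ℝ) * ((k : ℕ) : ℤ)) * ∑ i : Fin 4, X i k u ^ 2
          ≤ ∑ j ∈ Finset.Ico 0 L, (1 + ε₀) ^ ((2 : ℝ) * (j : ℤ)) * ∑ i : Fin 4, X i j u ^ 2 :=
        Finset.single_le_sum (f := fun j : ℕ => (1 + ε₀) ^ ((2 : ℝ) * (j : ℤ)) * ∑ i : Fin 4, X i j u ^ 2)
          (fun j _ => mul_nonneg (Real.rpow_nonneg hl0.le _) (Finset.sum_nonneg fun i _ => sq_nonneg _)) hkmem
      have hpk : 0 ≤ (1 + ε₀) ^ k := pow_nonneg hl0.le _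
      rw [hDL, hedef]; dsimp only
      calc ν * b * (1 + ε₀) ^ k = ν * ((1 + ε₀) ^ k * b) := by ring
        _ ≤ ν * ((1 + ε₀) ^ k * ((1 + ε₀) ^ k * ‖shellVec X k u‖ ^ 2)) :=
            mul_le_mul_of_nonneg_left (mul_le_mul_of_nonneg_left hu'.le hpk) hν.le
        _ = ν * ((1 + ε₀) ^ ((2 : ℝ) * ((k : ℕ) : ℤ)) * ∑ i : Fin 4, X i k u ^ 2) := by rw [hterm]
        _ ≤ ν * ∑ j ∈ Finset.Ico 0 L, (1 + ε₀) ^ ((2 : ℝ) * (j : ℤ)) * ∑ i : Fin 4, X i j u ^ 2 :=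
            mul_le_mul_of_nonneg_left hsingle hν.le
    -- the monotone potential `g = E₀ + cL·t − E_L`, `g' = cL + BL + DL ≥ 0`
    set g : ℝ → ℝ := fun w => E₀ + cL * w - EL w with hg
    set g' : ℝ → ℝ := fun u => cL + BL u + DL u with hg'
    have hgder : ∀ u ∈ Icc (0 : ℝ) T'', HasDerivWithinAt g (g' u) (Icc 0 T'') u := by
      intro u hu
      have h1 : HasDerivWithinAt (fun w => E₀ + cL * w) cL (Icc 0 T'') u := by
        have := ((hasDerivAt_id u).const_mul cL).const_add E₀
        simpa using this.hasDerivWithinAt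
      have h := h1.sub (hELder u hu)
      refine h.congr_deriv ?_
      rw [hg']; ring
    have hg'0 : ∀ u ∈ Icc (0 : ℝ) T'', 0 ≤ g' u := by
      intro u hu
      have h1 := hBLle u hu
      have h2 := hDL0 u
      rw [hg']; dsimp only
      linarith [neg_abs_le (BL u)]
    have hcont : ContinuousOn g (Icc 0 T') := by
      intro u hu
      have hu' : u ∈ Icc (0 : ℝ) T'' := ⟨hu.1, hu.2.trans hT'T''.le⟩
      exact ((hgder u hu').continuousWithinAt).mono (Icc_subset_Icc_right hT'T''.le)
    have hderiv : ∀ u ∈ Ioo (0 : ℝ) T', HasDerivAt g (g' u) u := by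
      intro u hu
      have hu' : u ∈ Icc (0 : ℝ) T'' := ⟨hu.1.le, (hu.2.trans hT'T'').le⟩
      exact (hgder u hu').hasDerivAt (Icc_mem_nhds hu.1 (hu.2.trans hT'T''))
    have hpos : ∀ u ∈ Ioo (0 : ℝ) T', 0 ≤ g' u := fun u hu => hg'0 u ⟨hu.1.le, (hu.2.trans hT'T'').le⟩
    have hint : IntegrableOn g' (Ioc 0 T') := intervalIntegral.integrableOn_deriv_of_nonneg hcont hderiv hpos
    -- FTC: `∫_{(0,T']} g' = g T' − g 0 ≤ E₀ + cL T'`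
    have hFTC : ∫ u in Ioc 0 T', g' u = g T' - g 0 := by
      rw [← intervalIntegral.integral_of_le hT'0.le]
      exact intervalIntegral.integral_eq_sub_of_hasDerivAt_of_le hT'0.le hcont hderiv
        ((intervalIntegrable_iff_integrableOn_Ioc_of_le hT'0.le).mpr hint)
    have hEL0 : EL 0 = E₀ := by
      rw [hEL, hE₀]; dsimp only
      rw [Finset.sum_eq_single_of_mem 0 (Finset.mem_Ico.mpr ⟨le_rfl, by omega⟩)]
      · simp [hinit]
      · intro j _ hj0
        simp [hinit, hj0]
    have hELT' : 0 ≤ EL T' := by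
      rw [hEL]; dsimp only
      exact Finset.sum_nonneg fun j _ => Finset.sum_nonneg fun i _ => by positivity
    have hIle : ∫ u in Ioc 0 T', g' u ≤ E₀ + cL * T' := by
      rw [hFTC, hg]; dsimp only; rw [hEL0]; linarith
    -- Markov on `(0,T']`
    have hae : 0 ≤ᵐ[volume.restrict (Ioc 0 T')] g' :=
      ae_restrict_of_forall_mem measurableSet_Ioc fun u hu => hg'0 u ⟨hu.1.le, hu.2.trans hT'T''.le⟩
    have hmarkov := mul_meas_ge_le_integral_of_nonneg hae hint e
    -- `S ∩ Ioc ⊆ {e ≤ g'} ∩ Ioc`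
    have hsub : S ∩ Ioc 0 T' ⊆ {u | e ≤ g' u} ∩ Ioc 0 T' := by
      intro u hu
      refine ⟨?_, hu.2⟩
      have h1 := hDLe u hu.1
      have h2 := hBLle u ⟨hu.2.1.le, hu.2.2.trans hT'T''.le⟩
      show e ≤ cL + BL u + DL u
      linarith [neg_abs_le (BL u)]
    have hfin : volume ({u | e ≤ g' u} ∩ Ioc 0 T') ≠ ⊤ := by
      refine ne_top_of_le_ne_top ?_ (measure_mono Set.inter_subset_right)
      rw [Real.volume_Ioc]; exact ENNReal.ofReal_ne_top
    have hreal : (volume.restrict (Ioc 0 T')).real {u | e ≤ g' u} = (volume ({u | e ≤ g' u} ∩ Ioc 0 T')).toReal := by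
      rw [measureReal_def, Measure.restrict_apply' measurableSet_Ioc]
    rw [hreal] at hmarkov
    have hmono : (volume (S ∩ Ioc 0 T')).toReal ≤ (volume ({u | e ≤ g' u} ∩ Ioc 0 T')).toReal :=
      ENNReal.toReal_mono hfin (measure_mono hsub)
    have h3 : e * (volume (S ∩ Ioc 0 T')).toReal ≤ E₀ + cL * T' :=
      (mul_le_mul_of_nonneg_left hmono he.le).trans (hmarkov.trans hIle)
    rw [le_div_iff₀ he]
    calc (volume (S ∩ Ioc 0 T')).toReal * e = e * (volume (S ∩ Ioc 0 T')).toReal := mul_comm _ _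
      _ ≤ E₀ + cL * T' := h3
      _ = E₀ + (4 : ℝ) ^ 3 * M ^ 3 * r ^ L * T' := by rw [hcL]
  -- `L → ∞`
  have hreal_le : (volume (S ∩ Ioc 0 T')).toReal ≤ E₀ / e := by
    refine le_of_forall_pos_le_add fun η hη => ?_
    -- choose `L > k` with `4³ M³ r^L T' / e ≤ η`
    obtain ⟨n, hn⟩ := exists_pow_lt_of_lt_one (show 0 < η * e / ((4 : ℝ) ^ 3 * M ^ 3 * T' + 1) by positivity) hr1
    set L : ℕ := max n (k + 1) with hLdef
    have hkL : k < L := by omega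
    have hrL : r ^ L ≤ r ^ n := pow_le_pow_of_le_one hr0.le hr1.le (le_max_left _ _)
    have h := hstep L hkL
    have hsmall : (4 : ℝ) ^ 3 * M ^ 3 * r ^ L * T' ≤ η * e := by
      have hA : 0 ≤ (4 : ℝ) ^ 3 * M ^ 3 * T' := by positivity
      have h1 : (4 : ℝ) ^ 3 * M ^ 3 * r ^ L * T' ≤ ((4 : ℝ) ^ 3 * M ^ 3 * T') * r ^ n := by
        calc (4 : ℝ) ^ 3 * M ^ 3 * r ^ L * T' = ((4 : ℝ) ^ 3 * M ^ 3 * T') * r ^ L := by ring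
          _ ≤ ((4 : ℝ) ^ 3 * M ^ 3 * T') * r ^ n := mul_le_mul_of_nonneg_left hrL hA
      have h2 : ((4 : ℝ) ^ 3 * M ^ 3 * T') * r ^ n ≤ ((4 : ℝ) ^ 3 * M ^ 3 * T' + 1) * (η * e / ((4 : ℝ) ^ 3 * M ^ 3 * T' + 1)) :=
        mul_le_mul (by linarith) hn.le (pow_nonneg hr0.le _) (by positivity)
      have h3 : ((4 : ℝ) ^ 3 * M ^ 3 * T' + 1) * (η * e / ((4 : ℝ) ^ 3 * M ^ 3 * T' + 1)) = η * e := by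
        field_simp
      linarith
    calc (volume (S ∩ Ioc 0 T')).toReal ≤ (E₀ + (4 : ℝ) ^ 3 * M ^ 3 * r ^ L * T') / e := h
      _ ≤ (E₀ + η * e) / e := div_le_div_of_nonneg_right (by linarith) he.le
      _ = E₀ / e + η := by field_simp
  -- back to `ℝ≥0∞`
  have hfinS : volume (S ∩ Ioc 0 T') ≠ ⊤ := by
    refine ne_top_of_le_ne_top ?_ (measure_mono Set.inter_subset_right)
    rw [Real.volume_Ioc]; exact ENNReal.ofReal_ne_top
  calc volume (S ∩ Ioc 0 T') = ENNReal.ofReal ((volume (S ∩ Ioc 0 T')).toReal) := (ENNReal.ofReal_toReal hfinS).symm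
    _ ≤ ENNReal.ofReal (E₀ / e) := ENNReal.ofReal_le_ofReal hreal_le
    _ = ENNReal.ofReal (E₀ / (ν * b * (1 + ε₀) ^ k)) := by rw [hedef]

/-- **(H1′) — LIT MEASURE, ONE POWER: the unconditional energy rung of `stub_litMeasureAtThreshold`.**  For a regular trajectory of the
NS-scaled `ν`-viscous lattice on `[0,T)` from the one-shell datum `X₀` (cancelling table with `|α_{··(0,0,1)}| ≤ 1`), every level `b > 0` and
every shell `k`: `volume {s ∈ [0,T) : b < λ^k‖X_k(s)‖²} ≤ E₀/(ν b) · (λ⁻¹)^k`, `E₀ = Σ_i ½X₀ᵢ²`.  (H1″) asks `(λ⁻²)^k` at the darkness level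
`b = ν²/(32768λ¹⁹)` along the threshold blow-up; the extra power is the feeder's clock (`litMeasure_of_frontClock₂`).  MODEL lattice only.
[cite: Tao2016AveragedNS, §4 proof of (4.13), Lemma 4.1 (4.5), (4.11)] -/
theorem litMeasure_le_energy {ε₀ ν T b : ℝ} (hε : 0 < ε₀) (hν : 0 < ν) (hT : 0 < T)
    {α : Fin 4 → Fin 4 → Fin 4 → ℤ × ℤ × ℤ → ℝ} (hcan : IsCancellingCoeff α)
    (hα1 : ∀ i₁ i₂ i₃, |α i₁ i₂ i₃ (0, 0, 1)| ≤ 1) {X : Fin 4 → ℤ → ℝ → ℝ} {X₀ : Fin 4 → ℝ}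
    (hcd : ∀ i n, ContDiffOn ℝ 1 (X i n) (Ico 0 T))
    (hinit : ∀ i n, X i n 0 = if n = 0 then X₀ i else 0)
    (hlow : ∀ i n t, n < 0 → X i n t = 0)
    (hmot : ∀ i n t, 0 ≤ t → t < T → derivWithin (X i n) (Ici 0) t =
      quadTerm ε₀ α X i n t - ν * (1 + ε₀) ^ ((2 : ℝ) * n) * X i n t)
    (hreg : ∀ T' : ℝ, 0 < T' → T' < T → ∃ M : ℝ, ∀ t : ℝ, 0 ≤ t → t ≤ T' →
      ∀ (i : Fin 4) (n : ℤ), (1 + (1 + ε₀) ^ ((10 : ℝ) * n)) * |X i n t| ≤ M)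
    (hb : 0 < b) (k : ℕ) :
    volume {s : ℝ | 0 ≤ s ∧ s < T ∧ b < (1 + ε₀) ^ k * ‖shellVec X k s‖ ^ 2} ≤
      ENNReal.ofReal ((∑ i : Fin 4, (1 / 2 : ℝ) * X₀ i ^ 2) / (ν * b) * ((1 + ε₀)⁻¹) ^ k) := by
  have hl0 : (0 : ℝ) < 1 + ε₀ := by linarith
  set S : Set ℝ := {s : ℝ | b < (1 + ε₀) ^ k * ‖shellVec X k s‖ ^ 2} with hSdef
  set E₀ : ℝ := ∑ i : Fin 4, (1 / 2 : ℝ) * X₀ i ^ 2 with hE₀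
  -- exhaust `[0,T)` by the windows `(0, T − T/(j+2)]` plus the null point `0`
  set Tj : ℕ → ℝ := fun j => T - T / ((j : ℝ) + 2) with hTj
  have hTj0 : ∀ j : ℕ, 0 < Tj j := by
    intro j; rw [hTj]; dsimp only
    have h2 : (2 : ℝ) ≤ (j : ℝ) + 2 := by linarith [(Nat.cast_nonneg j : (0 : ℝ) ≤ j)]
    have : T / ((j : ℝ) + 2) ≤ T / 2 := div_le_div_of_nonneg_left hT.le (by norm_num) h2
    linarith
  have hTjT : ∀ j : ℕ, Tj j < T := by
    intro j; rw [hTj]; dsimp only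
    have : 0 < T / ((j : ℝ) + 2) := by positivity
    linarith
  have hTjmono : Monotone Tj := by
    intro j j' hjj'
    rw [hTj]; dsimp only
    have h1 : (0 : ℝ) < (j : ℝ) + 2 := by positivity
    have h2 : (j : ℝ) + 2 ≤ (j' : ℝ) + 2 := by exact_mod_cast Nat.add_le_add_right hjj' 2
    have := div_le_div_of_nonneg_left hT.le h1 h2
    linarith
  have hcover : {s : ℝ | 0 ≤ s ∧ s < T ∧ b < (1 + ε₀) ^ k * ‖shellVec X k s‖ ^ 2} ⊆
      {0} ∪ ⋃ j : ℕ, (S ∩ Ioc 0 (Tj j)) := by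
    intro s hs
    obtain ⟨hs0, hsT, hsb⟩ := hs
    rcases hs0.eq_or_lt with h0 | hpos
    · exact Or.inl (by simp [← h0])
    · right
      -- pick `j` with `T/(j+2) ≤ T − s`
      obtain ⟨j, hj⟩ := exists_nat_gt (T / (T - s))
      refine mem_iUnion.mpr ⟨j, ⟨hsb, hpos, ?_⟩⟩
      rw [hTj]; dsimp only
      have hTs : 0 < T - s := by linarith
      have h1 : T / (T - s) < (j : ℝ) + 2 := by linarith
      have h2 : T / ((j : ℝ) + 2) < T - s := by
        rw [div_lt_iff₀ (by positivity)]
        have := (div_lt_iff₀ hTs).mp h1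
        linarith
      linarith
  have hmonoS : Monotone fun j : ℕ => S ∩ Ioc 0 (Tj j) :=
    fun j j' hjj' => Set.inter_subset_inter_right _ (Ioc_subset_Ioc_right (hTjmono hjj'))
  calc volume {s : ℝ | 0 ≤ s ∧ s < T ∧ b < (1 + ε₀) ^ k * ‖shellVec X k s‖ ^ 2}
      ≤ volume ({0} ∪ ⋃ j : ℕ, (S ∩ Ioc 0 (Tj j))) := measure_mono hcover
    _ ≤ volume ({0} : Set ℝ) + volume (⋃ j : ℕ, (S ∩ Ioc 0 (Tj j))) := measure_union_le _ _
    _ = ⨆ j : ℕ, volume (S ∩ Ioc 0 (Tj j)) := by rw [Real.volume_singleton, zero_add, hmonoS.measure_iUnion]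
    _ ≤ ENNReal.ofReal (E₀ / (ν * b) * ((1 + ε₀)⁻¹) ^ k) := by
        refine iSup_le fun j => ?_
        have h := litMeasure_window_le_energy hε hν hcan hα1 hcd hinit hlow hmot hreg (hTj0 j) (hTjT j) hb k
        refine h.trans (le_of_eq ?_)
        congr 1
        rw [hE₀, inv_pow]
        field_simp

end Summit.NavierStokesRegularity.NavierStokesRegularity.Theorems.MinimalViscousBlowup.ThresholdRay

end
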